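import Mathlib
import HarnessLib
import Summits.Langlands.Langlands.Theorems.SkinnerWilesDefectOneQuadraticBaseChangeGalois
import Literature.NumberTheory.Automorphic.BaseChangeStrongAllFinite
import Literature.NumberTheory.Automorphic.QuadraticBaseChangeFrobCompatibleSplitAuxFieldProofs
import Summits.Langlands.Langlands.Theses.SkinnerWilesDefectOne

/-!
# `QuadraticBaseChangeGaloisOfStrongLifting` (item stmt-Langlands-15195 of route `SkinnerWilesDefectOne`):
# what the antecedent buys, and the conditional closing link

The item is the rewire edge `StrongLiftingAllFinite → QuadraticBaseChangeGalois` of the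
route-choice repair of 2026-08-16 (route file rev 16): Langlands' quadratic base change for `GL₂` in
Galois-compatible form (the crux `QuadraticBaseChangeGalois`, item stmt-Langlands-15156) GIVEN
Arthur–Clozel's strong lifting at all finite places (the crux `StrongLiftingAllFinite`, item
stmt-Langlands-15194, verbatim the named fact `ArthurClozel1989_strongLifting_allFinite` —
`ArthurClozel1989_strongLifting_allFinite_iff`).

Nothing here is unconditional, and nothing can be in the tree's present state: the consequent is
base change for `GL₂` (existence AND cuspidality of the lift, its infinity type, and local–global
compatibility at the ramified primes of `π`), i.e. the twisted trace formula / Jacquet's converse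
theorem and Carayol's theorem, in the honest datum model (`HasSatakeParamAt` = Hecke eigenvalues on
level-`K(𝔫)` cusp forms, `HasInfinityType` = Harish-Chandra parameter of the `𝔤`-action).  The file
records which named facts carry the item and exactly what the antecedent buys:

* `quadraticBaseChangeGaloisOfStrongLifting_proof` — the closing link, from the crux's own three
  facts (1) `baseChange_cyclic_cuspidal`, (2) `ArthurClozel1989_strongLifting_archimedean`,
  (3) `Langlands1980_quadraticBaseChange_frobCompatible` (tree theorem
  `quadraticBaseChangeGalois_proof`); the antecedent is IDLE — the item is `fun h _ => h` from the
  crux.  (Fact (3) is itself reduced in the tree to Carayol's theorem over totally real fields in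
  the a.e. form (C') + (1) + (2) + `ArthurClozel1989_strongLifting_unramified`:
  `Langlands1980_quadraticBaseChange_frobCompatible_of_carayol'`.)
* (the planner's shape — antecedent at work at every `w ∤ p` over an UNRAMIFIED prime of `π`, via
  lang.S27 `exists_galoisRep_of_regularAlgebraic` over `ℚ`, residue = the `w ∤ p` over primes ramified
  for `π` with `ρ|_{Γ_F}` unramified at `w` — is the landed helper
  `quadraticBaseChangeGalois_of_strongLiftingAllFinite_of_residue` of `…QuadraticBaseChangeGaloisResidue`
  (p106710), fed the antecedent through `ArthurClozel1989_strongLifting_allFinite_iff`; not repeated.)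
* `quadraticBaseChangeGaloisOfStrongLifting_of_carayolRat_of_residue` — the sharpest: with Carayol's
  theorem over `ℚ` ONLY (classical weight `≥ 2` modular forms) in place of lang.S27 and fact (3), the
  antecedent settles every `w ∤ p` below which `ρ` is unramified, and the residue shrinks to the
  `w ∤ p` with `ℓ = w ∩ ℤ` ramified in `F`, `ρ` ramified at `ℓ`, `ρ|_{Γ_F}` unramified at `w` — inertia
  at `ℓ` of order two killed by `Γ_F`; automorphically the ramified principal series
  `π_ℓ = π(μ₁, μ₂)` of quadratic type, whose lift `π(μ₁ ∘ N, μ₂ ∘ N)` is unramified (Langlands 1980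
  §2 (i); Arthur–Clozel Ch. 1 §6) while `StrongLiftingAllFinite`, which speaks only of places where
  `π` HAS a Satake parameter, is silent (in the mixed case `ρ|_{I_ℓ} ≅ 1 ⊕ η` no Dirichlet twist of
  `π` is unramified at `ℓ` either).

So `StrongLiftingAllFinite` carries the crux everywhere except at that residue; the item's trust base
is {(1), (2), (3)} = the crux's, or {(1), (2), Carayol/ℚ, the order-two-inertia residue}.

## References

* R. P. Langlands, *Base Change for GL(2)*, Ann. of Math. Stud. 96 (1980), §2 (A), (F), (i).
  [LanglandsBaseChange1980]
* J. Arthur, L. Clozel, *Simple algebras, base change, and the advanced theory of the trace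
  formula*, Ann. of Math. Stud. 120 (1989), Ch. 3 Thm. 4.2 (a), Thm. 5.1, §1 (1.1); Ch. 1 §6–§7.
  [ArthurClozelAMS120]
* H. Carayol, *Sur les représentations ℓ-adiques associées aux formes modulaires de Hilbert*, Ann.
  Sci. ÉNS 19 (1986), Thm. (A), §0.5, §12.2. [CarayolASENS1986]
* K. Buzzard, T. Gee, *The conjectural connections between automorphic representations and Galois
  representations*, LMS Lecture Note Ser. 414 (2014), §5.3. [BuzzardGeeLMS2014]
-/

set_option linter.dupNamespace false -- project-wide option (lakefile weak.linter.dupNamespace); `Summit.Langlands.Langlands` is the mandated namespace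

open scoped NumberField
open NumberField IsDedekindDomain Filter
open Literature.NumberTheory.Automorphic Literature.NumberTheory.GaloisRepresentations

namespace Summit.Langlands.Langlands.Theorems.SkinnerWilesDefectOne

/-! ## What the antecedent buys: Carayol over `ℚ` + strong lifting at all finite places

With Carayol's local–global compatibility for `GL₂` over `ℚ` ALONE (classical modular forms of weight
`≥ 2`: Deligne, Langlands 1973, Carayol 1986 Thm. (A), in the a.e. form (C') restricted to `K = ℚ`)
the antecedent `StrongLiftingAllFinite` does all the remaining work at every finite `w ∤ p` at which
`ρ` ITSELF is unramified at `ℓ = w ∩ ℤ` — whatever the behaviour of `ℓ` in `F` (split, inert,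
ramified): (C') over `ℚ` makes `π_ℓ` unramified and gives the Frobenius polynomial of `ρ` at `ℓ`,
strong lifting at ALL finite places gives `t_{P,w} = t_{π,ℓ}^{f(w|ℓ)}`, and Frobenius polynomials
restrict (`hasFrobCharpolyAt_restrictField_arithFrobPolyOfSatake`, no ramification hypothesis).  If
`ρ` is ramified at `ℓ` while `ρ|_{Γ_F}` is unramified at `w`, then `ℓ` is ramified in `F` (Galois
descent of unramifiedness at a place unramified in `F/ℚ`,
`FramedGaloisRep.isUnramifiedAt_of_restrictField_of_under_eq`), `ρ(I_ℓ)` has order `2`, and this —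
the image of inertia at a prime ramified in `F` being killed by `Γ_F` — is the EXACT residue of the
item given its antecedent: on the automorphic side `π_ℓ` is then `π(μ₁, μ₂)` with
`{μ₁, μ₂}|_{ℤ_ℓ^×} ⊂ {1, η_{F_w/ℚ_ℓ}}` not both trivial, whose lift `π(μ₁ ∘ N, μ₂ ∘ N)` is unramified
(Langlands 1980 §2 (i)); when `ρ|_{I_ℓ}` is scalar (`= η`) the Dirichlet twist `π ⊗ η_F` is
unramified at `ℓ` and strong lifting of the twist would still decide it, when `ρ|_{I_ℓ} ≅ 1 ⊕ η`
(the mixed principal series) no twist helps and only the local lifting of RAMIFIED `π_ℓ` (absent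
from `StrongLiftingAllFinite`, which speaks of places where `π` has a Satake parameter) does.
lang.S27 is not needed in this shape. -/

/-- `(p) ∤ w` in `𝓞 F` implies `(p) ∤ w ∩ 𝓞 ℚ`. [folklore] -/
private theorem natCast_not_mem_under_rat {F : Type} [Field F] [NumberField F] {p : ℕ}
    {w : HeightOneSpectrum (𝓞 F)} (hwp : (p : 𝓞 F) ∉ w.asIdeal) :
    ((p : ℕ) : 𝓞 ℚ) ∉ (w.under (𝓞 ℚ)).asIdeal := by
  intro h
  apply hwp
  have h' : algebraMap (𝓞 ℚ) (𝓞 F) (p : 𝓞 ℚ) ∈ w.asIdeal := Ideal.mem_comap.mp h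
  rwa [map_natCast] at h'

/-- **The places where `ρ` is unramified below, from Carayol over `ℚ` and strong lifting at all
finite places.**  Let `F/ℚ` be quadratic, `π` cuspidal on `GL₂(𝔸_ℚ)` with a regular L-algebraic
infinity type `T`, `ρ : Γ_ℚ → GL₂(ℚ̄_p)` irreducible and Satake–Frobenius compatible with `π` at
almost all places, `P` a cuspidal weak base-change lift of `π` to `F`, and `w ∤ p` a finite place of
`F` such that `ρ` is unramified at `ℓ = w ∩ ℤ`.  Granted Carayol's theorem over `ℚ` in the a.e. form
(C') (the inline hypothesis `hCar`: Carayol 1986 Thm. (A) with §0.5, for `K = ℚ`) and Arthur–Clozel's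
strong lifting at ALL finite places (`ArthurClozel1989_strongLifting_allFinite`, Ch. 3 Thm. 5.1),
`P` has a Satake parameter `α` at `w` and the arithmetic Frobenii of `ρ|_{Γ_F}` at `w` have
characteristic polynomial `arithFrobPolyOfSatake ι q_w 1 α`.  Proof: (C') over `ℚ` applied to the
regular algebraic half-twist `π ⊗ |det|^{1/2}` (a.e. C-compatible with `ρ`) gives `π` unramified at
`ℓ` with Satake parameter `β` and the Frobenius polynomial of `ρ` at `ℓ`; strong lifting gives
`t_{P,w} = β^{f(w|ℓ)}`; Frobenius polynomials restrict to `w`.  No hypothesis on `ℓ` in `F`.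
[cite: CarayolASENS1986, Thm. (A) (pp. 410–411) with §0.5]
[cite: ArthurClozelAMS120, Ch. 3 Thm. 5.1 with §1 (1.1)] [cite: BuzzardGeeLMS2014, §5.3] -/
theorem satakeFrobCompatibleAt_restrictField_of_carayolRat_of_strongLiftingAllFinite
    (hCar : ∀ (hcpt : Literature.NumberTheory.Automorphic.isCompact_glFiniteIntegralLevel 2 ℚ)
      (π : Literature.NumberTheory.Automorphic.CuspidalAutomorphicRepData 2 ℚ hcpt),
      π.1.IsRegularAlgebraic →
      ∀ (ℓ : ℕ) [Fact ℓ.Prime] (ι : PadicAlgCl ℓ ≃+* ℂ)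
        (r : Literature.NumberTheory.GaloisRepresentations.FramedGaloisRep ℚ (PadicAlgCl ℓ) 2),
        r.toGaloisRep.IsIrreducible →
        (∀ᶠ v : HeightOneSpectrum (𝓞 ℚ) in cofinite,
          ∃ α : Multiset ℂ, π.1.HasSatakeParamAt v α ∧ r.IsUnramifiedAt v ∧
            r.HasFrobCharpolyAt v (arithFrobPolyOfSatake ι v.residueCard 2 α)) →
        ∀ w : HeightOneSpectrum (𝓞 ℚ), ((ℓ : ℕ) : 𝓞 ℚ) ∉ w.asIdeal →
          IsGaloisCompatibleAt π.1 ι r w ∧ (r.IsUnramifiedAt w → π.1.IsUnramifiedAt w))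
    (hAC : Literature.NumberTheory.Automorphic.ArthurClozel1989_strongLifting_allFinite)
    {F : Type} [Field F] [NumberField F] (hF2 : Module.finrank ℚ F = 2) {p : ℕ} [Fact p.Prime]
    (ι : PadicAlgCl p ≃+* ℂ) {hQ : isCompact_glFiniteIntegralLevel 2 ℚ}
    {hF : isCompact_glFiniteIntegralLevel 2 F} (π : CuspidalAutomorphicRepData 2 ℚ hQ)
    {T : InfinityType ℚ 2} (hT : π.1.HasInfinityType T) (hTL : T.IsLAlgebraic) (hTR : T.IsRegular)
    (ρ : FramedGaloisRep ℚ (PadicAlgCl p) 2) (hirr : ρ.toGaloisRep.IsIrreducible)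
    (hρ : ∀ᶠ v : HeightOneSpectrum (𝓞 ℚ) in cofinite,
      ∃ α : Multiset ℂ, π.1.HasSatakeParamAt v α ∧ ρ.IsUnramifiedAt v ∧
        ρ.HasFrobCharpolyAt v (arithFrobPolyOfSatake ι v.residueCard 1 α))
    (P : CuspidalAutomorphicRepData 2 F hF) (hBC : IsWeakBaseChangeLiftAE π.1 P.1)
    (w : HeightOneSpectrum (𝓞 F)) (hwp : (p : 𝓞 F) ∉ w.asIdeal)
    (hρℓ : ρ.IsUnramifiedAt (w.under (𝓞 ℚ))) :
    ∃ α : Multiset ℂ, P.1.HasSatakeParamAt w α ∧ (ρ.restrictField F).IsUnramifiedAt w ∧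
      (ρ.restrictField F).HasFrobCharpolyAt w (arithFrobPolyOfSatake ι w.residueCard 1 α) := by
  haveI : Algebra.IsQuadraticExtension ℚ F := ⟨hF2⟩
  haveI : IsGalois ℚ F := inferInstance
  have hprime : (Module.finrank ℚ F).Prime := hF2 ▸ Nat.prime_two
  -- (C') over `ℚ` for the regular algebraic half-twist `π' = π ⊗ |det|^{1/2}`
  obtain ⟨χ, π', hχ, hW, hW', hT'⟩ := π.exists_twist_hasInfinityType (((2 : ℝ) - 1) / 2) hT
  have hreg' : π'.1.IsRegularAlgebraic :=
    isRegularAlgebraic_of_hasInfinityType_twist_half (n := 2) (by exact_mod_cast hT') hTL hTR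
  have hχ' : ∀ x : ideleGroup ℚ,
      ((χ x : ℂˣ) : ℂ) = (ideleNorm x : ℂ) ^ (((((2 : ℕ) : ℝ) - 1) / 2 : ℝ) : ℂ) := by
    exact_mod_cast hχ
  have hρ' := eventually_satakeFrobCompatible_halfTwist (n := 2) ι ρ hρ hχ' hW hW'
  obtain ⟨hc, himp⟩ := hCar hQ π' hreg' p ι ρ hirr hρ' _ (natCast_not_mem_under_rat hwp)
  -- `π` is unramified at `ℓ`, with Satake parameter `β`, and `ρ` has the matching Frobenius
  -- polynomial at `ℓ`
  obtain ⟨β, hβ⟩ : π.1.IsUnramifiedAt (w.under (𝓞 ℚ)) :=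
    (isUnramifiedAt_iff_of_twist hχ hW hW' _).mp (himp hρℓ)
  obtain ⟨hur, hch⟩ := isUnramifiedAt_and_hasFrobCharpolyAt_one_of_isGaloisCompatibleAt_halfTwist
    (n := 2) ι ρ hχ' hW hW' hc hβ
  -- strong lifting at ALL finite places: `t_{P,w} = β^{f(w|ℓ)}`; Frobenius polynomials restrict
  exact ⟨_, hAC 2 ℚ F hprime hQ hF π P hBC w (w.under (𝓞 ℚ)) β rfl hβ,
    hasFrobCharpolyAt_restrictField_arithFrobPolyOfSatake (L := F) ι ρ (v := w.under (𝓞 ℚ))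
      (w := w) rfl hur 1 hch⟩

/-- **The item from Carayol over `ℚ`, with the antecedent at work, modulo the inertia-killed residue
at the primes ramified in `F`** (the sharpest certificate of item stmt-Langlands-15195).  Granted
(1) `baseChange_cyclic_cuspidal`, (2) `ArthurClozel1989_strongLifting_archimedean`, Carayol's
theorem over `ℚ` in the a.e. form (C') (inline hypothesis `hCar`, `K = ℚ` only), AND the explicit
residue `hres` — the conclusion of fact (3) demanded ONLY at the finite `w ∤ p` of `F` with
`ρ|_{Γ_F}` unramified at `w`, `ℓ = w ∩ ℤ` RAMIFIED in `F` and `ρ` RAMIFIED at `ℓ` (so `ρ(I_ℓ)` has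
order two: Langlands 1980 §2 (i), the ramified principal series of quadratic type and their
unramified lifts) —, the route decl
`QuadraticBaseChangeGaloisOfStrongLifting` holds (type literally the decl; first step `unfold`): strong
lifting at all finite places (the antecedent `StrongLiftingAllFinite`, =
`ArthurClozel1989_strongLifting_allFinite` by `Iff.rfl`) settles every other place (`satakeFrobCompatibleAt_restrictField_of_carayolRat_of_strongLiftingAllFinite`), the cuspidal
lift coming from (1) with the proved non-dihedral lemma and its infinity type from (2).
CONDITIONAL on (1), (2), (C')/ℚ and `hres`; lang.S27 is not used.
[cite: ArthurClozelAMS120, Ch. 3 Thm. 4.2 (a) and Thm. 5.1]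
[cite: CarayolASENS1986, Thm. (A) (pp. 410–411) with §0.5]
[cite: LanglandsBaseChange1980, §2 (A), (F) with (i)] -/
theorem quadraticBaseChangeGaloisOfStrongLifting_of_carayolRat_of_residue
    (h₁ : Literature.NumberTheory.Automorphic.baseChange_cyclic_cuspidal)
    (h₂ : Literature.NumberTheory.Automorphic.ArthurClozel1989_strongLifting_archimedean)
    (hCar : ∀ (hcpt : Literature.NumberTheory.Automorphic.isCompact_glFiniteIntegralLevel 2 ℚ)
      (π : Literature.NumberTheory.Automorphic.CuspidalAutomorphicRepData 2 ℚ hcpt),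
      π.1.IsRegularAlgebraic →
      ∀ (ℓ : ℕ) [Fact ℓ.Prime] (ι : PadicAlgCl ℓ ≃+* ℂ)
        (r : Literature.NumberTheory.GaloisRepresentations.FramedGaloisRep ℚ (PadicAlgCl ℓ) 2),
        r.toGaloisRep.IsIrreducible →
        (∀ᶠ v : HeightOneSpectrum (𝓞 ℚ) in cofinite,
          ∃ α : Multiset ℂ, π.1.HasSatakeParamAt v α ∧ r.IsUnramifiedAt v ∧
            r.HasFrobCharpolyAt v (arithFrobPolyOfSatake ι v.residueCard 2 α)) →
        ∀ w : HeightOneSpectrum (𝓞 ℚ), ((ℓ : ℕ) : 𝓞 ℚ) ∉ w.asIdeal →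
          IsGaloisCompatibleAt π.1 ι r w ∧ (r.IsUnramifiedAt w → π.1.IsUnramifiedAt w))
    (hres : ∀ (F : Type) [Field F] [NumberField F], Module.finrank ℚ F = 2 →
      ∀ (p : ℕ) [Fact p.Prime] (ι : PadicAlgCl p ≃+* ℂ)
        (hQ : Literature.NumberTheory.Automorphic.isCompact_glFiniteIntegralLevel 2 ℚ)
        (hF : Literature.NumberTheory.Automorphic.isCompact_glFiniteIntegralLevel 2 F)
        (π : Literature.NumberTheory.Automorphic.CuspidalAutomorphicRepData 2 ℚ hQ)
        (T : Literature.NumberTheory.Automorphic.InfinityType ℚ 2),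
        π.1.HasInfinityType T → T.IsLAlgebraic → T.IsRegular →
      ∀ (ρ : Literature.NumberTheory.GaloisRepresentations.FramedGaloisRep ℚ (PadicAlgCl p) 2),
        ρ.toGaloisRep.IsIrreducible →
        (∀ᶠ v : IsDedekindDomain.HeightOneSpectrum (NumberField.RingOfIntegers ℚ) in Filter.cofinite,
          ∃ α : Multiset ℂ, π.1.HasSatakeParamAt v α ∧ ρ.IsUnramifiedAt v ∧
            ρ.HasFrobCharpolyAt v
              (Literature.NumberTheory.Automorphic.arithFrobPolyOfSatake ι v.residueCard 1 α)) →
      ∀ (P : Literature.NumberTheory.Automorphic.CuspidalAutomorphicRepData 2 F hF),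
        Literature.NumberTheory.Automorphic.IsWeakBaseChangeLiftAE π.1 P.1 →
      ∀ w : IsDedekindDomain.HeightOneSpectrum (NumberField.RingOfIntegers F),
        (p : NumberField.RingOfIntegers F) ∉ w.asIdeal → (ρ.restrictField F).IsUnramifiedAt w →
        ¬ Algebra.IsUnramifiedIn (NumberField.RingOfIntegers F)
            (w.under (NumberField.RingOfIntegers ℚ)).asIdeal →
        ¬ ρ.IsUnramifiedAt (w.under (NumberField.RingOfIntegers ℚ)) →
        ∃ α : Multiset ℂ, P.1.HasSatakeParamAt w α ∧ (ρ.restrictField F).IsUnramifiedAt w ∧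
          (ρ.restrictField F).HasFrobCharpolyAt w
            (Literature.NumberTheory.Automorphic.arithFrobPolyOfSatake ι w.residueCard 1 α)) :
    Summit.Langlands.Langlands.Theses.SkinnerWilesDefectOne.QuadraticBaseChangeGaloisOfStrongLifting := by
  unfold Summit.Langlands.Langlands.Theses.SkinnerWilesDefectOne.QuadraticBaseChangeGaloisOfStrongLifting
    Summit.Langlands.Langlands.Theses.SkinnerWilesDefectOne.StrongLiftingAllFinite
    Summit.Langlands.Langlands.Theses.SkinnerWilesDefectOne.QuadraticBaseChangeGalois
  intro hSL F _ _ hdeg p _ hcptQ hcptF ι π T hT hTL hTR ρ hcompat hirrF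
  -- the antecedent is, verbatim, Arthur–Clozel's strong lifting at all finite places
  have hAC : Literature.NumberTheory.Automorphic.ArthurClozel1989_strongLifting_allFinite :=
    Literature.NumberTheory.Automorphic.ArthurClozel1989_strongLifting_allFinite_iff.mpr hSL
  -- `F/ℚ` quadratic: Galois of prime degree `2`
  haveI : Algebra.IsQuadraticExtension ℚ F := ⟨hdeg⟩
  haveI : IsGalois ℚ F := inferInstance
  have hprime : (Module.finrank ℚ F).Prime := hdeg ▸ Nat.prime_two
  -- `ρ` is irreducible since `ρ|_{Γ_F}` is
  have hρirr : ρ.toGaloisRep.IsIrreducible := isIrreducible_of_isIrreducible_restrictField F ρ hirrF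
  -- (1) + the non-dihedral lemma: the cuspidal weak base-change lift `P`; (2): its infinity type
  have hne :=
    EisensteinProModularSeed.exists_inert_hasSatakeParamAt_map_ne F hdeg ι π.1 ρ hcompat hirrF
  obtain ⟨P, hBC⟩ := h₁ 2 ℚ F hprime hcptQ π hne hcptF
  have hPT : P.1.HasInfinityType (T.baseChange F) :=
    h₂.hasInfinityType_baseChange inferInstance hprime hBC hT
  refine ⟨P, hPT, fun w hwp hunr => ?_⟩
  by_cases hρℓ : ρ.IsUnramifiedAt (w.under (𝓞 ℚ))
  · -- `ρ` unramified at `ℓ`: Carayol over `ℚ` + strong lifting at all finite places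
    exact satakeFrobCompatibleAt_restrictField_of_carayolRat_of_strongLiftingAllFinite hCar hAC hdeg
      ι π hT hTL hTR ρ hρirr hcompat P hBC w hwp hρℓ
  · -- `ρ` ramified at `ℓ` but `ρ|_{Γ_F}` unramified at `w`: `ℓ` is ramified in `F`; the residue
    have hram : ¬ Algebra.IsUnramifiedIn (𝓞 F) (w.under (𝓞 ℚ)).asIdeal := fun hℓF =>
      hρℓ (ρ.isUnramifiedAt_of_restrictField_of_under_eq hℓF rfl hunr)
    exact hres F hdeg p ι hcptQ hcptF π T hT hTL hTR ρ hρirr hcompat P hBC w hwp hunr hram hρℓ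

/-! ## The closing link -/

/-- **The route decl `QuadraticBaseChangeGaloisOfStrongLifting`, closing-shaped and CONDITIONAL**
(item stmt-Langlands-15195 of route `SkinnerWilesDefectOne`): granted the crux's three named facts
(1) `baseChange_cyclic_cuspidal` (Arthur–Clozel 1989, Ch. 3, Thm. 4.2 (a): the weak lift of a
cuspidal non-dihedral `π` exists and is cuspidal), (2) `ArthurClozel1989_strongLifting_archimedean`
(Thm. 5.1 at `∞` with Ch. 1 §7: infinity types restrict along the lift) and (3)
`Langlands1980_quadraticBaseChange_frobCompatible` (Langlands 1980 + Carayol 1986 Thm. (A), §12.2: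
compatibility with `ρ|_{Γ_F}` at every `w ∤ p` where it is unramified), the route statement
`StrongLiftingAllFinite → QuadraticBaseChangeGalois` holds — the consequent already follows from
(1)–(3) (`quadraticBaseChangeGalois_proof`, the certificate of the crux stmt-Langlands-15156), so the
antecedent is idle here; what it buys when facts are traded is
`quadraticBaseChangeGaloisOfStrongLifting_of_carayolRat_of_residue` above.  The type is literally the
route decl (first step `unfold`); the result is a `conditional-result` on (1)–(3), none of which is
discharged in the tree at `n = 2`.
[cite: LanglandsBaseChange1980, global base change lifting for GL(2), §2 (A), (F)]
[cite: ArthurClozelAMS120, Ch. 3 Thm. 4.2 (a) and Thm. 5.1] [cite: CarayolASENS1986, Thm. (A) and §12.2] -/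
theorem quadraticBaseChangeGaloisOfStrongLifting_proof
    (h₁ : Literature.NumberTheory.Automorphic.baseChange_cyclic_cuspidal)
    (h₂ : Literature.NumberTheory.Automorphic.ArthurClozel1989_strongLifting_archimedean)
    (h₃ : Literature.NumberTheory.Automorphic.Langlands1980_quadraticBaseChange_frobCompatible) :
    Summit.Langlands.Langlands.Theses.SkinnerWilesDefectOne.QuadraticBaseChangeGaloisOfStrongLifting := by
  unfold Summit.Langlands.Langlands.Theses.SkinnerWilesDefectOne.QuadraticBaseChangeGaloisOfStrongLifting
  exact fun _ => quadraticBaseChangeGalois_proof h₁ h₂ h₃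

end Summit.Langlands.Langlands.Theorems.SkinnerWilesDefectOne
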